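import Summits.Ventures.CertifiedManyBodySolver.Theorems.M3x2EdgeSplitSymReplaySoundD
import HarnessLib

/-!
# SymReplay checker — the ALGEBRA CORE of lever (η) «word-level factor rows»: bilinear regrouping of a Gram expansion by word pairs

(team lb-sym, cell hub-lb; hub-lb-sym-eng-3 g3.  PURE ALGEBRA, no checker syntax: the theorem the η enumerator module
instantiates to discharge the `hsem` obligation of the semantic skeleton `…OutRouteHSem` (p665136).  Design note:
`Cruxes/LowerEdge_ge_m83o100/ETA-symeng3.md`.)

THE IDENTITY.  A Gram R-block contributes, term by term, `Σ_{i} Σ_{j} (c_i · c'_j · ⟪v_i, v'_j⟫) • g(u_i, w_j)` where `i`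
ranges over the REPRESENTATIVE terms (coefficient `c_i`, word `u_i`, factor row `v_i`), `j` over the generated BASIS terms,
`⟪·,·⟫` is the (bilinear) row dot product and `g(u, w)` the operator of the product word `u† ++ w`.  Many index pairs carry
the same WORD pair.  Grouping by word pairs and using bilinearity,
    `… = Σ_{u} Σ_{w} ⟪σ_u, ρ_w⟫ • g(u, w)`,   `σ_u := Σ_{i : u_i = u} c_i • v_i`,   `ρ_w := Σ_{j : w_j = w} c'_j • v'_j`
— one emitted product per DISTINCT word pair (E₁: 333 708 239 → 219 486 051 products, census kit j317218), with the
word-level factor rows `σ, ρ` computed once per block.  Stated over finite index types, an abstract `ℚ`-module of rows with a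
bilinear form, and an abstract `ℚ`-module of values; the η module instantiates rows = dense `Fin K → ℚ` (or MFD's dense lists
via their `dotProduct` bridge), values = operators, `g u w = wordOp Λ' (u† ++ w)`.

CONTENTS.  `aggr` (the word-level aggregate `σ`/`ρ`), `bilin_aggr_aggr` (bilinear expansion of `⟪σ_u, ρ_w⟫`),
**`eta_regroup`** (the identity above), `eta_regroup_ne_zero` (the same with the zero-dot pairs dropped on the left, as the
enumerators of record do with `if ⟪L_i, L_j⟫ = 0 then none`), `eta_regroup_ne_zero'` (zero word-pair dots dropped on the
right as well).  A module's word-level SELECTION (moment slot of `u† ++ w`, secondary key `κ₂`) is a predicate `P u w` on the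
KEYS, so it is absorbed into `g` (`g' u w := if P u w then g u w else 0`) and needs no separate statement.  INSTANTIATION
RECIPE for the η enumerator module: index the block's representative terms by `Fin nA` and basis terms by `Fin nB`
(`List.sum_ofFn` / `List.map_ofFn` / `List.ofFn_getElem` turn the emitted list sums into these `Finset.univ` sums), take
`V := Fin K_B → ℚ` with `d := Matrix.dotProduct` as a bilinear map (or MFD's dense-list dot through its bridge) and tie
`⟪L_i, L_j⟫ = sdot L_i L_j` by `sdot_eq_sum` (…SoundD); `M :=` the operator module, `g u w := wordOp Λ' (adjWord u ++ w)`.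
Standard axioms; Mathlib only (imports `…SoundD` merely to sit inside the checker's import cone).

HONEST FRAMING: an algebraic identity for a replay-COST lever; no certificate lands by this file; no bound of record moves
(#529 −0.8295699476 outside Lean; tree floor −0.8942613047 computational; stmt-Ventures-22024 met BY VALUE only, un-landed;
stmt-Ventures-21721 open); no summit or crux statement is proved here; nothing here predicts superconductivity.
-/

namespace Summit.Ventures.CertifiedManyBodySolver.Theorems.SymReplay.EtaAlgebra

open scoped BigOperators

variable {ι κ α β V M : Type*} [Fintype ι] [Fintype κ] [DecidableEq α] [DecidableEq β]
  [AddCommGroup V] [Module ℚ V] [AddCommGroup M] [Module ℚ M]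

/-- **Word-level aggregate** of an indexed term family `(key, coefficient, row)`: `σ_u = Σ_{i : key i = u} c_i • v_i`. -/
def aggr (key : ι → α) (c : ι → ℚ) (v : ι → V) (u : α) : V :=
  ∑ i ∈ Finset.univ.filter (fun i => key i = u), c i • v i

/-- Bilinear expansion of `⟪σ_u, ρ_w⟫`. -/
theorem bilin_aggr_aggr (d : V →ₗ[ℚ] V →ₗ[ℚ] ℚ) (kA : ι → α) (cA : ι → ℚ) (vA : ι → V) (kB : κ → β) (cB : κ → ℚ)
    (vB : κ → V) (u : α) (w : β) :
    d (aggr kA cA vA u) (aggr kB cB vB w) =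
      ∑ i ∈ Finset.univ.filter (fun i => kA i = u), ∑ j ∈ Finset.univ.filter (fun j => kB j = w),
        cA i * cB j * d (vA i) (vB j) := by
  unfold aggr
  simp only [map_sum, map_smul, LinearMap.sum_apply, LinearMap.smul_apply, smul_eq_mul, Finset.mul_sum]
  rw [Finset.sum_comm]
  refine Finset.sum_congr rfl fun i _ => ?_
  refine Finset.sum_congr rfl fun j _ => ?_
  ring

/-- **η REGROUPING**: the term-by-term Gram expansion equals the word-pair expansion with word-level factor rows.
`SA ⊇ keys of A`, `SB ⊇ keys of B` (e.g. the deduplicated key lists). -/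
theorem eta_regroup (d : V →ₗ[ℚ] V →ₗ[ℚ] ℚ) (g : α → β → M) (kA : ι → α) (cA : ι → ℚ) (vA : ι → V) (kB : κ → β)
    (cB : κ → ℚ) (vB : κ → V) (SA : Finset α) (hA : ∀ i, kA i ∈ SA) (SB : Finset β) (hB : ∀ j, kB j ∈ SB) :
    (∑ i, ∑ j, (cA i * cB j * d (vA i) (vB j)) • g (kA i) (kB j)) =
      ∑ u ∈ SA, ∑ w ∈ SB, d (aggr kA cA vA u) (aggr kB cB vB w) • g u w := by
  -- expand the right-hand side bilinearly and push the scalar sum through `•`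
  have hR : ∀ u w, d (aggr kA cA vA u) (aggr kB cB vB w) • g u w =
      ∑ i ∈ Finset.univ.filter (fun i => kA i = u), ∑ j ∈ Finset.univ.filter (fun j => kB j = w),
        (cA i * cB j * d (vA i) (vB j)) • g (kA i) (kB j) := by
    intro u w
    rw [bilin_aggr_aggr, Finset.sum_smul]
    refine Finset.sum_congr rfl fun i hi => ?_
    rw [Finset.sum_smul]
    refine Finset.sum_congr rfl fun j hj => ?_
    rw [(Finset.mem_filter.1 hi).2, (Finset.mem_filter.1 hj).2]
  simp_rw [hR]
  -- regroup: Σ_u Σ_{i ∈ fiber u} Σ_w Σ_{j ∈ fiber w} = Σ_i Σ_j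
  have hinner : ∀ i, (∑ w ∈ SB, ∑ j ∈ Finset.univ.filter (fun j => kB j = w),
      (cA i * cB j * d (vA i) (vB j)) • g (kA i) (kB j)) =
      ∑ j, (cA i * cB j * d (vA i) (vB j)) • g (kA i) (kB j) := fun i =>
    Finset.sum_fiberwise_of_maps_to (fun j _ => hB j) _
  calc (∑ i, ∑ j, (cA i * cB j * d (vA i) (vB j)) • g (kA i) (kB j))
      = ∑ u ∈ SA, ∑ i ∈ Finset.univ.filter (fun i => kA i = u),
          ∑ j, (cA i * cB j * d (vA i) (vB j)) • g (kA i) (kB j) :=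
        (Finset.sum_fiberwise_of_maps_to (fun i _ => hA i) _).symm
    _ = ∑ u ∈ SA, ∑ i ∈ Finset.univ.filter (fun i => kA i = u), ∑ w ∈ SB,
          ∑ j ∈ Finset.univ.filter (fun j => kB j = w), (cA i * cB j * d (vA i) (vB j)) • g (kA i) (kB j) := by
        simp_rw [hinner]
    _ = ∑ u ∈ SA, ∑ w ∈ SB, ∑ i ∈ Finset.univ.filter (fun i => kA i = u),
          ∑ j ∈ Finset.univ.filter (fun j => kB j = w), (cA i * cB j * d (vA i) (vB j)) • g (kA i) (kB j) := by
        refine Finset.sum_congr rfl fun u _ => ?_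
        rw [Finset.sum_comm]

/-- The same identity with the ZERO-DOT index pairs dropped on the left (the enumerators of record skip `⟪L_i, L_j⟫ = 0`). -/
theorem eta_regroup_ne_zero (d : V →ₗ[ℚ] V →ₗ[ℚ] ℚ) (g : α → β → M) (kA : ι → α) (cA : ι → ℚ) (vA : ι → V)
    (kB : κ → β) (cB : κ → ℚ) (vB : κ → V) (SA : Finset α) (hA : ∀ i, kA i ∈ SA) (SB : Finset β)
    (hB : ∀ j, kB j ∈ SB) :
    (∑ i, ∑ j ∈ Finset.univ.filter (fun j => d (vA i) (vB j) ≠ 0), (cA i * cB j * d (vA i) (vB j)) • g (kA i) (kB j)) =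
      ∑ u ∈ SA, ∑ w ∈ SB, d (aggr kA cA vA u) (aggr kB cB vB w) • g u w := by
  rw [← eta_regroup d g kA cA vA kB cB vB SA hA SB hB]
  refine Finset.sum_congr rfl fun i _ => ?_
  rw [Finset.sum_filter]
  refine Finset.sum_congr rfl fun j _ => ?_
  by_cases h : d (vA i) (vB j) = 0
  · simp [h]
  · simp [h]

/-- Likewise the η side may drop the word pairs with `⟪σ_u, ρ_w⟫ = 0`. -/
theorem eta_regroup_ne_zero' (d : V →ₗ[ℚ] V →ₗ[ℚ] ℚ) (g : α → β → M) (kA : ι → α) (cA : ι → ℚ) (vA : ι → V)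
    (kB : κ → β) (cB : κ → ℚ) (vB : κ → V) (SA : Finset α) (hA : ∀ i, kA i ∈ SA) (SB : Finset β)
    (hB : ∀ j, kB j ∈ SB) :
    (∑ i, ∑ j ∈ Finset.univ.filter (fun j => d (vA i) (vB j) ≠ 0), (cA i * cB j * d (vA i) (vB j)) • g (kA i) (kB j)) =
      ∑ u ∈ SA, ∑ w ∈ SB.filter (fun w => d (aggr kA cA vA u) (aggr kB cB vB w) ≠ 0),
        d (aggr kA cA vA u) (aggr kB cB vB w) • g u w := by
  rw [eta_regroup_ne_zero d g kA cA vA kB cB vB SA hA SB hB]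
  refine Finset.sum_congr rfl fun u _ => ?_
  rw [Finset.sum_filter]
  refine Finset.sum_congr rfl fun w _ => ?_
  by_cases h : d (aggr kA cA vA u) (aggr kB cB vB w) = 0
  · simp [h]
  · simp [h]

end Summit.Ventures.CertifiedManyBodySolver.Theorems.SymReplay.EtaAlgebra
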